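import Mathlib

/-!
# Three MOLS from a binary operation satisfying the pentagonal cycle identity `I5`

Cell `pub-namedobj`, target (M) "3 MOLS(10)". Framing: lottery ticket; floor = certified
bounds/negative ranges.

Let `mul : α → α → α` be a binary operation with left cancellation satisfying

  `I5 :  (y * (x*y)) * ((x*y) * (y * (x*y))) = x`   for all `x y`.

Write `p₀ = x, p₁ = y, p₂ = x*y, p₃ = y*(x*y), p₄ = (x*y)*(y*(x*y))`. Then `pᵢ₊₂ = pᵢ * pᵢ₊₁` holds
cyclically (indices mod 5; the case `i = 3` is `I5`, the case `i = 4` follows from `I5` applied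
twice), so the map `(x,y) ↦ (y, x*y)` permutes the 5-tuples `(p₀,…,p₄)` cyclically and any two of
the five coordinate maps `α × α → α` are jointly injective. Reading `p₀, p₁` as row and column,
`L₁ = p₂, L₂ = p₃, L₃ = p₄` are three mutually orthogonal Latin squares whose orthogonal array is
invariant under the cyclic shift of its five coordinates. This is the algebraic form of the census
family "C5" (a set of 3 MOLS(n) admitting an automorphism permuting the five parallel classes
cyclically); in the idempotent case it is the classical correspondence between perfect Mendelsohn
designs with block size 5 and quasigroups. Nothing published is used as a hypothesis: every
statement below is proved, and the order-4 control object is checked by the kernel.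
-/

namespace Summit.Ventures.DiscreteObjects.MOLS

variable {α : Type*}

/-- Two squares `A B : α → α → α` (row, column ↦ symbol) are orthogonal: the map
cell ↦ (symbol of `A`, symbol of `B`) is injective. -/
def Orthogonal (A B : α → α → α) : Prop :=
  ∀ x y x' y', A x y = A x' y' → B x y = B x' y' → x = x' ∧ y = y'

/-- `L` is a Latin square: every row `L x ·` and every column `L · y` is injective. -/
def IsLatin (L : α → α → α) : Prop :=
  (∀ x y y', L x y = L x y' → y = y') ∧ (∀ y x x', L x y = L x' y → x = x')

/-- The pentagonal cycle identity `I5`: `(y * (x*y)) * ((x*y) * (y * (x*y))) = x`. -/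
def IdentityI5 (mul : α → α → α) : Prop :=
  ∀ x y, mul (mul y (mul x y)) (mul (mul x y) (mul y (mul x y))) = x

/-- Left cancellation: `x * y = x * y' → y = y'`. -/
def LeftCancel (mul : α → α → α) : Prop :=
  ∀ x y y', mul x y = mul x y' → y = y'

/-- First square `L₁(x,y) = x*y`. -/
def sq1 (mul : α → α → α) (x y : α) : α := mul x y
/-- Second square `L₂(x,y) = y*(x*y)`. -/
def sq2 (mul : α → α → α) (x y : α) : α := mul y (mul x y)
/-- Third square `L₃(x,y) = (x*y)*(y*(x*y))`. -/
def sq3 (mul : α → α → α) (x y : α) : α := mul (mul x y) (mul y (mul x y))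

section relations

variable (mul : α → α → α)

/-- The fifth cyclic relation `p₄ * p₀ = p₁`, from `I5` at `(x,y)` and at `(y, x*y)`. -/
theorem rel4 (h5 : IdentityI5 mul) (x y : α) :
    mul (mul (mul x y) (mul y (mul x y))) x = y := by
  have h1 : mul (mul y (mul x y)) (mul (mul x y) (mul y (mul x y))) = x := h5 x y
  have h2 : mul (mul (mul x y) (mul y (mul x y)))
      (mul (mul y (mul x y)) (mul (mul x y) (mul y (mul x y)))) = y := h5 y (mul x y)
  rw [h1] at h2
  exact h2

/-- Cyclic invariance of the orthogonal array: the 5-tuple of the cell `(y, x*y)` is the 5-tuple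
`(x, y, L₁, L₂, L₃)` of the cell `(x,y)` shifted by one place. -/
theorem tuple_shift (h5 : IdentityI5 mul) (x y : α) :
    (sq1 mul y (mul x y), sq2 mul y (mul x y), sq3 mul y (mul x y)) =
      (sq2 mul x y, sq3 mul x y, x) := by
  have h1 : mul (mul y (mul x y)) (mul (mul x y) (mul y (mul x y))) = x := h5 x y
  simp only [sq1, sq2, sq3, Prod.mk.injEq, true_and]
  exact h1

end relations

section cycle

variable {mul : α → α → α} {x y x' y' : α}

/-- Agreement on `(p₂,p₃)` forces agreement of the cells. -/
theorem eq_of_p2_p3 (h5 : IdentityI5 mul) (ha : mul x y = mul x' y')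
    (hb : mul y (mul x y) = mul y' (mul x' y')) : x = x' ∧ y = y' := by
  have hc : mul (mul x y) (mul y (mul x y)) = mul (mul x' y') (mul y' (mul x' y')) := by
    rw [hb, ha]
  have hx : x = x' := by
    calc x = mul (mul y (mul x y)) (mul (mul x y) (mul y (mul x y))) := (h5 x y).symm
      _ = mul (mul y' (mul x' y')) (mul (mul x' y') (mul y' (mul x' y'))) := by rw [hb, ha]
      _ = x' := h5 x' y'
  have hy : y = y' := by
    calc y = mul (mul (mul x y) (mul y (mul x y))) x := (rel4 mul h5 x y).symm
      _ = mul (mul (mul x' y') (mul y' (mul x' y'))) x' := by rw [hc, hx]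
      _ = y' := rel4 mul h5 x' y'
  exact ⟨hx, hy⟩

/-- Agreement on `(p₃,p₄)` forces agreement of the cells. -/
theorem eq_of_p3_p4 (h5 : IdentityI5 mul) (hb : mul y (mul x y) = mul y' (mul x' y'))
    (hc : mul (mul x y) (mul y (mul x y)) = mul (mul x' y') (mul y' (mul x' y'))) :
    x = x' ∧ y = y' := by
  have hx : x = x' := by
    calc x = mul (mul y (mul x y)) (mul (mul x y) (mul y (mul x y))) := (h5 x y).symm
      _ = mul (mul y' (mul x' y')) (mul (mul x' y') (mul y' (mul x' y'))) := by rw [hc, hb]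
      _ = x' := h5 x' y'
  have hy : y = y' := by
    calc y = mul (mul (mul x y) (mul y (mul x y))) x := (rel4 mul h5 x y).symm
      _ = mul (mul (mul x' y') (mul y' (mul x' y'))) x' := by rw [hc, hx]
      _ = y' := rel4 mul h5 x' y'
  exact ⟨hx, hy⟩

/-- Agreement on `(p₄,p₀)` forces agreement of the cells. -/
theorem eq_of_p4_p0 (h5 : IdentityI5 mul)
    (hc : mul (mul x y) (mul y (mul x y)) = mul (mul x' y') (mul y' (mul x' y'))) (hx : x = x') :
    x = x' ∧ y = y' := by
  have hy : y = y' := by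
    calc y = mul (mul (mul x y) (mul y (mul x y))) x := (rel4 mul h5 x y).symm
      _ = mul (mul (mul x' y') (mul y' (mul x' y'))) x' := by rw [hc, hx]
      _ = y' := rel4 mul h5 x' y'
  exact ⟨hx, hy⟩

/-- Agreement on `(p₁,p₂)` forces agreement of the cells. -/
theorem eq_of_p1_p2 (h5 : IdentityI5 mul) (hy : y = y') (ha : mul x y = mul x' y') :
    x = x' ∧ y = y' := by
  have hb : mul y (mul x y) = mul y' (mul x' y') := by rw [ha, hy]
  exact eq_of_p2_p3 h5 ha hb

/-- Agreement on `(p₀,p₂)` forces agreement of the cells (uses left cancellation). -/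
theorem eq_of_p0_p2 (hl : LeftCancel mul) (hx : x = x') (ha : mul x y = mul x' y') :
    x = x' ∧ y = y' := by
  subst hx
  exact ⟨rfl, hl x y y' ha⟩

/-- Agreement on `(p₁,p₃)` forces agreement of the cells (uses left cancellation). -/
theorem eq_of_p1_p3 (hl : LeftCancel mul) (h5 : IdentityI5 mul) (hy : y = y')
    (hb : mul y (mul x y) = mul y' (mul x' y')) : x = x' ∧ y = y' := by
  subst hy
  have ha : mul x y = mul x' y := hl y _ _ hb
  exact eq_of_p1_p2 h5 rfl ha

/-- Agreement on `(p₂,p₄)` forces agreement of the cells (uses left cancellation). -/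
theorem eq_of_p2_p4 (hl : LeftCancel mul) (h5 : IdentityI5 mul) (ha : mul x y = mul x' y')
    (hc : mul (mul x y) (mul y (mul x y)) = mul (mul x' y') (mul y' (mul x' y'))) :
    x = x' ∧ y = y' := by
  have hc' : mul (mul x' y') (mul y (mul x y)) = mul (mul x' y') (mul y' (mul x' y')) := by
    calc mul (mul x' y') (mul y (mul x y)) = mul (mul x y) (mul y (mul x y)) := by rw [ha]
      _ = mul (mul x' y') (mul y' (mul x' y')) := hc
  have hb : mul y (mul x y) = mul y' (mul x' y') := hl _ _ _ hc'
  exact eq_of_p2_p3 h5 ha hb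

/-- Agreement on `(p₃,p₀)` forces agreement of the cells (uses left cancellation). -/
theorem eq_of_p3_p0 (hl : LeftCancel mul) (h5 : IdentityI5 mul)
    (hb : mul y (mul x y) = mul y' (mul x' y')) (hx : x = x') : x = x' ∧ y = y' := by
  have hC : mul (mul y' (mul x' y')) (mul (mul x y) (mul y (mul x y))) =
      mul (mul y' (mul x' y')) (mul (mul x' y') (mul y' (mul x' y'))) := by
    calc mul (mul y' (mul x' y')) (mul (mul x y) (mul y (mul x y)))
          = mul (mul y (mul x y)) (mul (mul x y) (mul y (mul x y))) := by rw [hb]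
      _ = x := h5 x y
      _ = x' := hx
      _ = mul (mul y' (mul x' y')) (mul (mul x' y') (mul y' (mul x' y'))) := (h5 x' y').symm
  have hc : mul (mul x y) (mul y (mul x y)) = mul (mul x' y') (mul y' (mul x' y')) := hl _ _ _ hC
  exact eq_of_p3_p4 h5 hb hc

/-- Agreement on `(p₄,p₁)` forces agreement of the cells (uses left cancellation). -/
theorem eq_of_p4_p1 (hl : LeftCancel mul) (h5 : IdentityI5 mul)
    (hc : mul (mul x y) (mul y (mul x y)) = mul (mul x' y') (mul y' (mul x' y'))) (hy : y = y') :
    x = x' ∧ y = y' := by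
  have hX : mul (mul (mul x' y') (mul y' (mul x' y'))) x =
      mul (mul (mul x' y') (mul y' (mul x' y'))) x' := by
    calc mul (mul (mul x' y') (mul y' (mul x' y'))) x
          = mul (mul (mul x y) (mul y (mul x y))) x := by rw [hc]
      _ = y := rel4 mul h5 x y
      _ = y' := hy
      _ = mul (mul (mul x' y') (mul y' (mul x' y'))) x' := (rel4 mul h5 x' y').symm
  have hx : x = x' := hl _ _ _ hX
  exact ⟨hx, hy⟩

end cycle

section mols

variable {mul : α → α → α}

/-- `L₁ = x*y` is a Latin square. -/
theorem isLatin_sq1 (hl : LeftCancel mul) (h5 : IdentityI5 mul) : IsLatin (sq1 mul) :=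
  ⟨fun _ y y' h => (eq_of_p0_p2 (y := y) (y' := y') hl rfl h).2,
   fun _ x x' h => (eq_of_p1_p2 (x := x) (x' := x') h5 rfl h).1⟩

/-- `L₂ = y*(x*y)` is a Latin square. -/
theorem isLatin_sq2 (hl : LeftCancel mul) (h5 : IdentityI5 mul) : IsLatin (sq2 mul) :=
  ⟨fun _ y y' h => (eq_of_p3_p0 (y := y) (y' := y') hl h5 h rfl).2,
   fun _ x x' h => (eq_of_p1_p3 (x := x) (x' := x') hl h5 rfl h).1⟩

/-- `L₃ = (x*y)*(y*(x*y))` is a Latin square. -/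
theorem isLatin_sq3 (hl : LeftCancel mul) (h5 : IdentityI5 mul) : IsLatin (sq3 mul) :=
  ⟨fun _ y y' h => (eq_of_p4_p0 (y := y) (y' := y') h5 h rfl).2,
   fun _ x x' h => (eq_of_p4_p1 (x := x) (x' := x') hl h5 h rfl).1⟩

/-- `L₁ ⟂ L₂` (no cancellation needed). -/
theorem orthogonal_sq1_sq2 (h5 : IdentityI5 mul) : Orthogonal (sq1 mul) (sq2 mul) :=
  fun _ _ _ _ ha hb => eq_of_p2_p3 h5 ha hb

/-- `L₂ ⟂ L₃` (no cancellation needed). -/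
theorem orthogonal_sq2_sq3 (h5 : IdentityI5 mul) : Orthogonal (sq2 mul) (sq3 mul) :=
  fun _ _ _ _ hb hc => eq_of_p3_p4 h5 hb hc

/-- `L₁ ⟂ L₃`. -/
theorem orthogonal_sq1_sq3 (hl : LeftCancel mul) (h5 : IdentityI5 mul) :
    Orthogonal (sq1 mul) (sq3 mul) :=
  fun _ _ _ _ ha hc => eq_of_p2_p4 hl h5 ha hc

/-- **Main theorem.** A binary operation with left cancellation satisfying `I5` yields three
mutually orthogonal Latin squares `L₁, L₂, L₃` on its carrier (rows, columns and symbols all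
indexed by `α`). For `|α| = 10` such an operation would give 3 MOLS(10); the census family C5
searches exactly for it. -/
theorem three_MOLS_of_identityI5 (hl : LeftCancel mul) (h5 : IdentityI5 mul) :
    IsLatin (sq1 mul) ∧ IsLatin (sq2 mul) ∧ IsLatin (sq3 mul) ∧
      Orthogonal (sq1 mul) (sq2 mul) ∧ Orthogonal (sq1 mul) (sq3 mul) ∧
        Orthogonal (sq2 mul) (sq3 mul) :=
  ⟨isLatin_sq1 hl h5, isLatin_sq2 hl h5, isLatin_sq3 hl h5, orthogonal_sq1_sq2 h5,
    orthogonal_sq1_sq3 hl h5, orthogonal_sq2_sq3 h5⟩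

end mols

section example4

/-- The order-4 control object found by the census exact-cover engine (`dlx_c5`, n = 4, first
labelled solution): Cayley table rows `[0,3,1,2],[1,2,0,3],[2,1,3,0],[3,0,2,1]`. -/
def mul4 (x y : Fin 4) : Fin 4 :=
  ![![0, 3, 1, 2], ![1, 2, 0, 3], ![2, 1, 3, 0], ![3, 0, 2, 1]] x y

/-- control (+): `mul4` satisfies `I5` (kernel `decide`). -/
theorem mul4_identityI5 : IdentityI5 mul4 := by
  unfold IdentityI5 mul4; decide

/-- control (+): `mul4` has left cancellation (kernel `decide`). -/
theorem mul4_leftCancel : LeftCancel mul4 := by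
  unfold LeftCancel mul4; decide

/-- control (+): hence three MOLS(4) whose orthogonal array has the cyclic coordinate symmetry. -/
theorem three_MOLS_four : IsLatin (sq1 mul4) ∧ IsLatin (sq2 mul4) ∧ IsLatin (sq3 mul4) ∧
    Orthogonal (sq1 mul4) (sq2 mul4) ∧ Orthogonal (sq1 mul4) (sq3 mul4) ∧
      Orthogonal (sq2 mul4) (sq3 mul4) :=
  three_MOLS_of_identityI5 mul4_leftCancel mul4_identityI5

end example4

section reduction

set_option maxRecDepth 20000 in
set_option synthInstance.maxHeartbeats 400000 in
set_option synthInstance.maxSize 1024 in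
/-- Group-theoretic core of the reduction "[McKay–Meynert–Myrvold 2007] ⇒ the automorphism group of
the orthogonal array of any 3 MOLS(10) is trivial or cyclic of order 5 acting as a 5-cycle on the
five coordinates" (cell pub-namedobj, FAMILY-C5 §1 (b),(c)): if a permutation `σ` of the five
coordinates and its square both act as the identity on every 3-subset they stabilise (which is
what triviality of all autoparatopy groups of the ten coordinate-triple squares gives), then `σ` is
the identity or a fixed-point-free permutation with `σ⁵ = 1`. The hypothesis on `σ²` is needed:
a 4-cycle stabilises no 3-subset. Kernel `decide` over the 120 permutations of `Fin 5`. -/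
theorem perm_fin5_eq_one_or_five_cycle (σ : Equiv.Perm (Fin 5))
    (h : ∀ T : Finset (Fin 5), T.card = 3 →
      ((∀ i ∈ T, σ i ∈ T) → ∀ i ∈ T, σ i = i) ∧
      ((∀ i ∈ T, σ (σ i) ∈ T) → ∀ i ∈ T, σ (σ i) = i)) :
    σ = 1 ∨ ((∀ i, σ i ≠ i) ∧ σ ^ 5 = 1) := by
  revert σ
  decide

end reduction

section reduction2

/-- Every coordinate of `Fin 5` lies in some 3-subset (explicit witnesses). -/
theorem exists_card_three_mem (i : Fin 5) : ∃ T : Finset (Fin 5), T.card = 3 ∧ i ∈ T := by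
  fin_cases i
  · exact ⟨{0, 1, 2}, by decide, by decide⟩
  · exact ⟨{0, 1, 2}, by decide, by decide⟩
  · exact ⟨{0, 1, 2}, by decide, by decide⟩
  · exact ⟨{2, 3, 4}, by decide, by decide⟩
  · exact ⟨{2, 3, 4}, by decide, by decide⟩

/-- Reduction step (FAMILY-C5 §1 (a)–(c)) for an automorphism `(π; σ₀,…,σ₄)` of the orthogonal
array of a set of 3 MOLS (coordinate permutation `π`, symbol permutations `σ i`): if on every
3-subset `T` of coordinates stabilised by `π` the induced autoparatopism of the square on `T` is
trivial (conjugating part `π|_T = id` and isotopy part `σ i = 1` for `i ∈ T`) — which is what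
[McKay–Meynert–Myrvold 2007] gives at order 10 — and the coordinate action of the square of the
automorphism also fixes pointwise every 3-subset it stabilises, then either the automorphism is the
identity or `π` is fixed-point-free with `π⁵ = 1`. -/
theorem oa_aut_trivial_or_five_cycle {β : Type*} (π : Equiv.Perm (Fin 5))
    (σ : Fin 5 → Equiv.Perm β)
    (h : ∀ T : Finset (Fin 5), T.card = 3 →
      ((∀ i ∈ T, π i ∈ T) → (∀ i ∈ T, π i = i) ∧ (∀ i ∈ T, σ i = 1)) ∧
      ((∀ i ∈ T, π (π i) ∈ T) → ∀ i ∈ T, π (π i) = i)) :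
    (π = 1 ∧ ∀ i, σ i = 1) ∨ ((∀ i, π i ≠ i) ∧ π ^ 5 = 1) := by
  have hw : ∀ T : Finset (Fin 5), T.card = 3 →
      ((∀ i ∈ T, π i ∈ T) → ∀ i ∈ T, π i = i) ∧
      ((∀ i ∈ T, π (π i) ∈ T) → ∀ i ∈ T, π (π i) = i) := by
    intro T hT
    exact ⟨fun hs => ((h T hT).1 hs).1, (h T hT).2⟩
  rcases perm_fin5_eq_one_or_five_cycle π hw with h1 | h5
  · left
    refine ⟨h1, fun i => ?_⟩
    obtain ⟨T, hT, hi⟩ := exists_card_three_mem i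
    have hs : ∀ j ∈ T, π j ∈ T := by
      intro j hj
      simpa [h1] using hj
    exact ((h T hT).1 hs).2 i hi
  · right; exact h5

/-- The orthogonal array `{(x, y, L₀ x y, L₁ x y, L₂ x y)}` of three squares is invariant under the
cyclic shift of its five coordinates: the shifted tuple of the cell `(x,y)` is the tuple of the cell
`(y, L₀ x y)` (FAMILY-C5 §1 (e)). -/
def ShiftInvariant (L₀ L₁ L₂ : α → α → α) : Prop :=
  ∀ x y, L₀ y (L₀ x y) = L₁ x y ∧ L₁ y (L₀ x y) = L₂ x y ∧ L₂ y (L₀ x y) = x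

/-- Part (e), forward: shift invariance forces `L₁ = sq2 L₀`, `L₂ = sq3 L₀` and the identity `I5`
for `L₀`. -/
theorem identityI5_of_shiftInvariant {L₀ L₁ L₂ : α → α → α} (h : ShiftInvariant L₀ L₁ L₂) :
    IdentityI5 L₀ ∧ (∀ x y, L₁ x y = sq2 L₀ x y) ∧ (∀ x y, L₂ x y = sq3 L₀ x y) := by
  have h1 : ∀ x y, L₁ x y = L₀ y (L₀ x y) := fun x y => ((h x y).1).symm
  have h2 : ∀ x y, L₂ x y = L₀ (L₀ x y) (L₀ y (L₀ x y)) := by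
    intro x y
    rw [← (h x y).2.1, h1]
  refine ⟨?_, h1, h2⟩
  intro x y
  have h3 := (h x y).2.2
  rw [h2] at h3
  exact h3

/-- Part (e), converse: an operation satisfying `I5` gives a shift-invariant orthogonal array with
`L₁ = sq2`, `L₂ = sq3` (cf. `tuple_shift`). -/
theorem shiftInvariant_of_identityI5 {mul : α → α → α} (h5 : IdentityI5 mul) :
    ShiftInvariant (sq1 mul) (sq2 mul) (sq3 mul) := by
  intro x y
  refine ⟨rfl, rfl, ?_⟩
  exact h5 x y

end reduction2

end Summit.Ventures.DiscreteObjects.MOLS
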